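import Literature.NumberTheory.BeurlingPrimes.BDRMultisetStieltjes
import Literature.NumberTheory.BeurlingPrimes.BVRiemannCount
import Literature.NumberTheory.BeurlingPrimes.ComplexPowerDensity
import Literature.NumberTheory.BeurlingPrimes.RiemannPrimeCountPsi
import HarnessLib

/-!
# BDR Theorem 3.2, the prime side: `Π_𝒫 = G + O(log x)` and `ψ_𝒫(x) = x + Σ_ω x^ω/ω − Σ_ρ x^ρ/ρ + O(x^δ)`

Topic `Literature/NumberTheory/BeurlingPrimes`, grouping namespace `BDRMultiset`. Everything in this file is PROVED.

Broucke–Debruyne–Révész (2023), proof of Theorem 3.2: from a Beurling system `𝒫` with `|π_𝒫 − F| ≤ 2` (Theorem 1.2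
applied to the template `F` of Lemma 3.1) they derive `Π_𝒫(x) = G(x) + O(log log x)` with
`G(x) = Σ_k F(x^{1/k})/k`, and then, "Since `ψ_𝒫(x) := ∫_1^x log u dΠ_𝒫(u)`" and
"`∫_1^x log u dLi(u^z) = (x^z − 1)/z − log x`", the first assertion
`ψ_𝒫(x) = x + Σ_{ω∈𝒮} x^ω/ω − Σ_{ρ∈ℛ} x^ρ/ρ + M x^δ/δ + O(log x log log x)`, "which in particular demonstrates
the first assertion" `… + O(x^δ)`. Here (with the real-part template of `BDRMultisetTemplate.lean`, the tree's carriers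
`primeCount = π_𝒫`, `riemannPrimeCount = Π_𝒫`, `chebyshevPsi = ψ_𝒫`, and the hypothesis `|π_𝒫(y) − F(y)| ≤ A'`):

* `sum_map_eq_ofReal_of_symm` — for a symmetric multiset, `Σ_{ω∈𝒮} φ(ω)` is real when `φ(ω̄) = \overline{φ(ω)}`;
* `abs_riemannPrimeCount_sub_tmplG_le` — **`|Π_𝒫(x) − G(x)| ≤ A′ log x/log λ₀ + 2Kλ₀ log λ₀`** for all `x ≥ 1` (the
  printed `O(log log x)` is not needed downstream; the proof is the tree's `abs_riemannPrimeCount_sub_Li_le` with `li`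
  replaced by `F`, using `F(y) ≤ K(y − 1) ≤ K y log y`);
* `tmplG_mul_log_sub_integral` — the Abel identity `G(x) log x − ∫_1^x G(u) du/u = ∫_1^x NG(log u) du/u`, and
  `integral_NG_log_div` — its evaluation `(x − 1 − log x) + Σ_𝒮 Re((x^ω−1)/ω − log x) − Σ_ℛ Re(…) + M((x^δ−1)/δ − log x)`;
* `chebyshevPsi_clause` — **the `ψ`-clause of Theorem 3.2**: there is `C` with
  `‖ψ_𝒫(x) − (x + Σ_{ω∈𝒮} x^ω/ω − Σ_{ρ∈ℛ} x^ρ/ρ)‖ ≤ C x^δ` for `x ≥ 1` (symmetric `𝒮, ℛ`, `0 < Re ω, Re ρ`, `0 < δ`).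

## References
* [BrouckeDebruyneRevesz2023] F. Broucke, G. Debruyne, Sz. Gy. Révész, *Some examples of well-behaved Beurling
  number systems*, arXiv:2309.01567, proof of Theorem 3.2 (from "Theorem 1.2 thus provides" to "demonstrates the
  first assertion") (read).
-/

noncomputable section

open Filter Topology Complex Set MeasureTheory intervalIntegral
open scoped ComplexConjugate

namespace Literature.NumberTheory.BeurlingPrimes

open Literature.Barriers.RiemannHypothesis

/-! ### Symmetric multisets -/

/-- For a symmetric multiset `X` (`X.map conj = X`) and `φ` with `φ(z̄) = \overline{φ(z)}`, the sum `Σ_{z∈X} φ(z)` is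
real: `Σ φ(z) = ↑(Σ Re φ(z))`. [cite: BrouckeDebruyneRevesz2023, §3 (symmetric multisets)] -/
theorem sum_map_eq_ofReal_of_symm {X : Multiset ℂ} (hX : X.map conj = X) {φ : ℂ → ℂ}
    (hφ : ∀ z, φ (conj z) = conj (φ z)) : (X.map φ).sum = (((X.map fun z ↦ (φ z).re).sum : ℝ) : ℂ) := by
  set s : ℂ := (X.map φ).sum with hs
  have hconj : conj s = s := by
    rw [hs, ← Complex.conjAe_coe, map_multiset_sum, Multiset.map_map]
    have h1 : (fun z ↦ Complex.conjAe (φ z)) = φ ∘ conj := by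
      funext z; simp [hφ]
    rw [show (⇑Complex.conjAe ∘ φ) = fun z ↦ Complex.conjAe (φ z) from rfl, h1, ← Multiset.map_map, hX]
  have hre : s.re = (X.map fun z ↦ (φ z).re).sum := by
    change Complex.reAddGroupHom s = _
    rw [hs, map_multiset_sum, Multiset.map_map]
    rfl
  rw [← hre]
  exact (Complex.conj_eq_iff_re.1 hconj).symm

namespace BDRMultiset

variable {R S : Multiset ℂ} {δ : ℝ} {M : ℕ} {P : BeurlingPrimes} {A' : ℝ}

/-! ### `Π_𝒫 − G = O(log x)` -/

/-- `F(y) ≤ K (y − 1)` with the constant `K` of `tmplF_le_mul_Li` (`Li(y) ≤ y − 1`). [folklore] -/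
theorem tmplF_le_mul_sub_one (hS : ∀ ω ∈ S, ω.re ≤ 1) (hR : ∀ ρ ∈ R, ρ.re ≤ 1) (hδ : 0 ≤ δ) (hδ1 : δ ≤ 1)
    (hpos : ∀ L : ℝ, 0 < L → 0 ≤ NF R S δ M L) {y : ℝ} (hy : 1 ≤ y) :
    tmplF R S δ M y ≤ 2 * ((sizeBound R S M * normBound R S * Real.exp (normBound R S) +
      (1 + (3 + 2 * Hc R S) * (1 + Multiset.card S + Multiset.card R) + M)) +
      (1 + (3 + 2 * Hc R S) * (1 + Multiset.card S + Multiset.card R) + M)) * (y - 1) := by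
  have hB := sizeBound_nonneg (R := R) (S := S) (M := M)
  have hQ := normBound_nonneg (R := R) (S := S)
  have hH := one_le_Hc R S
  refine (tmplF_le_mul_Li hS hR hδ hδ1 hpos hy).trans ?_
  exact mul_le_mul_of_nonneg_left (Li_le_sub_one hy) (by positivity)

/-- **`|Π_𝒫(x) − G(x)| ≤ A′ log x/log λ₀ + 2Kλ₀ log λ₀` for `x ≥ 1`** when `|π_𝒫(y) − F(y)| ≤ A′` for all `y ≥ 1`
(BDR: "`Π_𝒫(x) = Σ_{k ≤ log x/log p₁} (1/k)(F(x^{1/k}) + O(1)) = G(x) + O(log log x)`"; we keep the cruder head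
bound `Σ_{k ≤ log x/log p₁} A′/k ≤ A′ log x/log p₁`). [cite: BrouckeDebruyneRevesz2023, proof of Theorem 3.2 (3.2)–(3.3)] -/
theorem abs_riemannPrimeCount_sub_tmplG_le (hS : ∀ ω ∈ S, ω.re ≤ 1) (hR : ∀ ρ ∈ R, ρ.re ≤ 1) (hδ : 0 ≤ δ)
    (hδ1 : δ ≤ 1) (hpos : ∀ L : ℝ, 0 < L → 0 ≤ NF R S δ M L)
    (hπ : ∀ y : ℝ, 1 ≤ y → |(P.primeCount y : ℝ) - tmplF R S δ M y| ≤ A') {x : ℝ} (hx : 1 ≤ x) :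
    |P.riemannPrimeCount x - tmplG R S δ M x| ≤
      A' * (Real.log x / Real.log (P.prime 0)) +
        2 * (2 * ((sizeBound R S M * normBound R S * Real.exp (normBound R S) +
          (1 + (3 + 2 * Hc R S) * (1 + Multiset.card S + Multiset.card R) + M)) +
          (1 + (3 + 2 * Hc R S) * (1 + Multiset.card S + Multiset.card R) + M))) *
          P.prime 0 * Real.log (P.prime 0) := by
  set K : ℝ := 2 * ((sizeBound R S M * normBound R S * Real.exp (normBound R S) +
      (1 + (3 + 2 * Hc R S) * (1 + Multiset.card S + Multiset.card R) + M)) +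
      (1 + (3 + 2 * Hc R S) * (1 + Multiset.card S + Multiset.card R) + M)) with hK
  have hB := sizeBound_nonneg (R := R) (S := S) (M := M)
  have hQ := normBound_nonneg (R := R) (S := S)
  have hH := one_le_Hc R S
  have hK0 : 0 ≤ K := by positivity
  have hx0 : 0 < x := by linarith
  have hA' : 0 ≤ A' := le_trans (abs_nonneg _) (hπ 1 le_rfl)
  have hp0 : 1 < P.prime 0 := P.one_lt
  have hlp : 0 < Real.log (P.prime 0) := Real.log_pos hp0
  have hlx : 0 ≤ Real.log x := Real.log_nonneg hx
  -- the two series and their difference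
  set y : ℕ → ℝ := fun k ↦ x ^ (1 / ((k : ℝ) + 1)) with hydef
  have hy1 : ∀ k, 1 ≤ y k := fun k ↦ Real.one_le_rpow hx (by positivity)
  have hlogy : ∀ k, Real.log (y k) = Real.log x / ((k : ℝ) + 1) := by
    intro k; rw [hydef]; simp only; rw [Real.log_rpow hx0]; ring
  set d : ℕ → ℝ := fun k ↦ ((P.primeCount (y k) : ℝ) - tmplF R S δ M (y k)) / ((k : ℝ) + 1) with hddef
  have hd : HasSum d (P.riemannPrimeCount x - tmplG R S δ M x) := by
    have h := (hasSum_primeCount_rpow_div P hx0.le).sub (hasSum_tmplF_rpow_div (R := R) (S := S) (M := M) hδ hδ1 hx)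
    refine h.congr_fun fun k ↦ ?_
    simp only [hddef, hydef]; ring
  -- cut-off
  set N : ℕ := ⌊Real.log x / Real.log (P.prime 0)⌋₊ with hN
  have hNle : (N : ℝ) ≤ Real.log x / Real.log (P.prime 0) := Nat.floor_le (div_nonneg hlx hlp.le)
  have hNlt : Real.log x / Real.log (P.prime 0) < (N : ℝ) + 1 := Nat.lt_floor_add_one _
  -- head
  have hhead : |∑ k ∈ Finset.range N, d k| ≤ A' * (Real.log x / Real.log (P.prime 0)) := by
    have h1 : |∑ k ∈ Finset.range N, d k| ≤ ∑ k ∈ Finset.range N, A' := by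
      refine (Finset.abs_sum_le_sum_abs _ _).trans (Finset.sum_le_sum fun k _ ↦ ?_)
      simp only [hddef, abs_div, abs_of_pos (by positivity : (0 : ℝ) < k + 1)]
      calc |(P.primeCount (y k) : ℝ) - tmplF R S δ M (y k)| / ((k : ℝ) + 1)
          ≤ |(P.primeCount (y k) : ℝ) - tmplF R S δ M (y k)| / 1 :=
            div_le_div_of_nonneg_left (abs_nonneg _) one_pos (by linarith [(Nat.cast_nonneg k : (0:ℝ) ≤ k)])
        _ ≤ A' := by rw [div_one]; exact hπ (y k) (hy1 k)
    rw [Finset.sum_const, Finset.card_range, nsmul_eq_mul] at h1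
    exact h1.trans (by nlinarith)
  -- tail
  have htail_pt : ∀ k : ℕ, |d (k + N)| ≤ K * P.prime 0 * Real.log x * (1 / (((k + N + 1 : ℕ) : ℝ)) ^ 2) := by
    intro k
    have hk1 : (0 : ℝ) < (k : ℝ) + N + 1 := by positivity
    have hylt : y (k + N) < P.prime 0 := by
      have hlog : Real.log (y (k + N)) < Real.log (P.prime 0) := by
        rw [hlogy, div_lt_iff₀ (by push_cast; positivity)]
        calc Real.log x = Real.log x / Real.log (P.prime 0) * Real.log (P.prime 0) := by field_simp
          _ < ((N : ℝ) + 1) * Real.log (P.prime 0) := mul_lt_mul_of_pos_right hNlt hlp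
          _ ≤ (((k + N : ℕ) : ℝ) + 1) * Real.log (P.prime 0) := by
              refine mul_le_mul_of_nonneg_right ?_ hlp.le; push_cast; linarith [(Nat.cast_nonneg k : (0:ℝ) ≤ k)]
          _ = Real.log (P.prime 0) * (((k + N : ℕ) : ℝ) + 1) := by ring
      exact (Real.log_lt_log_iff (by linarith [hy1 (k + N)]) (by linarith)).mp hlog
    have hπ0 : P.primeCount (y (k + N)) = 0 := by
      rw [P.primeCount_eq_indexOf]; exact P.indexOf_eq_zero_of_lt_prime_zero hylt
    have hF : tmplF R S δ M (y (k + N)) ≤ K * P.prime 0 * Real.log x / (((k + N : ℕ) : ℝ) + 1) := by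
      have h1 : tmplF R S δ M (y (k + N)) ≤ K * (y (k + N) * Real.log (y (k + N))) := by
        have := tmplF_le_mul_sub_one (M := M) hS hR hδ hδ1 hpos (hy1 (k + N))
        rw [← hK] at this
        exact this.trans (mul_le_mul_of_nonneg_left (sub_one_le_mul_log (hy1 _)) hK0)
      rw [hlogy] at h1
      refine h1.trans ?_
      have : K * (y (k + N) * (Real.log x / (((k + N : ℕ) : ℝ) + 1))) = K * y (k + N) * Real.log x / (((k + N : ℕ) : ℝ) + 1) := by
        push_cast; ring
      rw [this]
      refine div_le_div_of_nonneg_right ?_ (by positivity)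
      exact mul_le_mul_of_nonneg_right (mul_le_mul_of_nonneg_left hylt.le hK0) hlx
    have hF0 : 0 ≤ tmplF R S δ M (y (k + N)) := tmplF_nonneg hδ hδ1 hpos _
    simp only [hddef, hπ0, Nat.cast_zero, zero_sub, abs_div, abs_neg, abs_of_nonneg hF0]
    rw [abs_of_pos (by positivity : (0:ℝ) < ((k + N : ℕ) : ℝ) + 1), div_le_iff₀ (by positivity)]
    refine hF.trans (le_of_eq ?_)
    push_cast
    field_simp
  have hsum2 : Summable fun k : ℕ ↦ 1 / (((k + N + 1 : ℕ) : ℝ)) ^ 2 := by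
    have := (summable_nat_add_iff (N + 1)).mpr (Real.summable_one_div_nat_pow.mpr one_lt_two)
    refine this.congr fun k ↦ ?_
    push_cast; ring_nf
  have htail : |∑' k, d (k + N)| ≤ 2 * K * P.prime 0 * Real.log (P.prime 0) := by
    have h1 : ‖∑' k, d (k + N)‖ ≤ ∑' k, K * P.prime 0 * Real.log x * (1 / (((k + N + 1 : ℕ) : ℝ)) ^ 2) :=
      tsum_of_norm_bounded (hsum2.mul_left _).hasSum fun k ↦ by rw [Real.norm_eq_abs]; exact htail_pt k
    rw [Real.norm_eq_abs, tsum_mul_left] at h1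
    refine h1.trans ?_
    have h2 := tsum_inv_sq_shift_le N
    have hlx0 : 0 ≤ K * P.prime 0 * Real.log x := by positivity
    calc K * P.prime 0 * Real.log x * ∑' k : ℕ, 1 / (((k + N + 1 : ℕ) : ℝ)) ^ 2
        ≤ K * P.prime 0 * Real.log x * (2 / ((N : ℝ) + 1)) := mul_le_mul_of_nonneg_left h2 hlx0
      _ = 2 * K * P.prime 0 * (Real.log x / ((N : ℝ) + 1)) := by ring
      _ ≤ 2 * K * P.prime 0 * Real.log (P.prime 0) := by
          refine mul_le_mul_of_nonneg_left ?_ (by positivity)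
          rw [div_le_iff₀ (by positivity)]
          calc Real.log x = Real.log x / Real.log (P.prime 0) * Real.log (P.prime 0) := by field_simp
            _ ≤ ((N : ℝ) + 1) * Real.log (P.prime 0) := mul_le_mul_of_nonneg_right hNlt.le hlp.le
            _ = Real.log (P.prime 0) * ((N : ℝ) + 1) := by ring
  have hsplit : P.riemannPrimeCount x - tmplG R S δ M x = ∑ k ∈ Finset.range N, d k + ∑' k, d (k + N) := by
    rw [← hd.tsum_eq]
    exact (hd.summable.sum_add_tsum_nat_add N).symm
  rw [hsplit]
  exact (abs_add_le _ _).trans (add_le_add hhead htail)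

/-- **`|Π_𝒫(x) − G(x)| ≤ C(1 + log x)` for all `x ≥ 1`**, with one constant. [cite: BrouckeDebruyneRevesz2023, proof of Theorem 3.2] -/
theorem exists_abs_riemannPrimeCount_sub_tmplG_le (hS : ∀ ω ∈ S, ω.re ≤ 1) (hR : ∀ ρ ∈ R, ρ.re ≤ 1) (hδ : 0 ≤ δ)
    (hδ1 : δ ≤ 1) (hpos : ∀ L : ℝ, 0 < L → 0 ≤ NF R S δ M L)
    (hπ : ∀ y : ℝ, 1 ≤ y → |(P.primeCount y : ℝ) - tmplF R S δ M y| ≤ A') :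
    ∃ C : ℝ, 0 ≤ C ∧ ∀ x : ℝ, 1 ≤ x → |P.riemannPrimeCount x - tmplG R S δ M x| ≤ C * (1 + Real.log x) := by
  set K : ℝ := 2 * ((sizeBound R S M * normBound R S * Real.exp (normBound R S) +
      (1 + (3 + 2 * Hc R S) * (1 + Multiset.card S + Multiset.card R) + M)) +
      (1 + (3 + 2 * Hc R S) * (1 + Multiset.card S + Multiset.card R) + M)) with hK
  have hB := sizeBound_nonneg (R := R) (S := S) (M := M)
  have hQ := normBound_nonneg (R := R) (S := S)
  have hH := one_le_Hc R S
  have hK0 : 0 ≤ K := by positivity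
  have hA' : 0 ≤ A' := le_trans (abs_nonneg _) (hπ 1 le_rfl)
  have hlp : 0 < Real.log (P.prime 0) := Real.log_pos P.one_lt
  have hp0 : 0 ≤ P.prime 0 := le_of_lt (lt_trans one_pos P.one_lt)
  refine ⟨A' / Real.log (P.prime 0) + 2 * K * P.prime 0 * Real.log (P.prime 0), by positivity, fun x hx ↦ ?_⟩
  have h := abs_riemannPrimeCount_sub_tmplG_le (M := M) hS hR hδ hδ1 hpos hπ hx
  rw [← hK] at h
  have hlx : 0 ≤ Real.log x := Real.log_nonneg hx
  have h1 : A' * (Real.log x / Real.log (P.prime 0)) = A' / Real.log (P.prime 0) * Real.log x := by ring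
  rw [h1] at h
  have h2 : 0 ≤ A' / Real.log (P.prime 0) := by positivity
  have h3 : 0 ≤ 2 * K * P.prime 0 * Real.log (P.prime 0) := by positivity
  nlinarith

/-! ### The Abel identity for `G` -/

/-- `u ↦ NG(log u)/u` is continuous on `(0, ∞)`. [folklore] -/
theorem continuousOn_NG_log_div (hδ : 0 ≤ δ) (hδ1 : δ ≤ 1) :
    ContinuousOn (fun u ↦ NG R S δ M (Real.log u) / u) (Ioi 0) :=
  ((continuous_NG hδ hδ1).comp_continuousOn (Real.continuousOn_log.mono fun _ hu ↦ ne_of_gt hu)).div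
    continuousOn_id fun _ hu ↦ ne_of_gt hu

/-- **`G(x) log x − ∫_1^x G(u) du/u = ∫_1^x NG(log u) du/u`** (`x ≥ 1`; `= ∫_1^x log u dG(u)`), by the mean value
theorem as in the tree's `Li_mul_log_sub_integral`. [cite: BrouckeDebruyneRevesz2023, proof of Theorem 3.2] -/
theorem tmplG_mul_log_sub_integral (hδ : 0 ≤ δ) (hδ1 : δ ≤ 1) {x : ℝ} (hx : 1 ≤ x) :
    tmplG R S δ M x * Real.log x - ∫ u in (1 : ℝ)..x, tmplG R S δ M u / u =
      ∫ u in (1 : ℝ)..x, NG R S δ M (Real.log u) / u := by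
  rcases hx.eq_or_lt with h1 | h1
  · rw [← h1]; simp [tmplG_of_le_one (le_refl (1:ℝ))]
  have hGc : Continuous (tmplG R S δ M) := continuous_tmplG hδ hδ1
  have hGdiv : ContinuousOn (fun u ↦ tmplG R S δ M u / u) (Ioi 0) :=
    hGc.continuousOn.div continuousOn_id fun _ hu ↦ ne_of_gt hu
  have hN := continuousOn_NG_log_div (R := R) (S := S) (M := M) hδ hδ1
  have hint1 : ∀ y : ℝ, 1 ≤ y → IntervalIntegrable (fun u ↦ tmplG R S δ M u / u) volume 1 y := fun y hy ↦
    (hGdiv.mono fun u hu ↦ lt_of_lt_of_le one_pos (by rw [uIcc_of_le hy] at hu; exact hu.1)).intervalIntegrable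
  have hint2 : ∀ y : ℝ, 1 ≤ y → IntervalIntegrable (fun u ↦ NG R S δ M (Real.log u) / u) volume 1 y := fun y hy ↦
    (hN.mono fun u hu ↦ lt_of_lt_of_le one_pos (by rw [uIcc_of_le hy] at hu; exact hu.1)).intervalIntegrable
  set Φ : ℝ → ℝ := fun y ↦ tmplG R S δ M y * Real.log y - (∫ u in (1 : ℝ)..y, tmplG R S δ M u / u) -
    ∫ u in (1 : ℝ)..y, NG R S δ M (Real.log u) / u with hΦ
  have hlog : ContinuousOn Real.log (Icc 1 x) :=
    Real.continuousOn_log.mono fun u hu ↦ ne_of_gt (lt_of_lt_of_le one_pos hu.1)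
  have hΦc : ContinuousOn Φ (Icc 1 x) := by
    refine ((hGc.continuousOn.mul hlog).sub ?_).sub ?_
    · have h := intervalIntegral.continuousOn_primitive_interval' (hint1 x hx) (show (1 : ℝ) ∈ uIcc 1 x from left_mem_uIcc)
      rw [uIcc_of_le hx] at h; exact h
    · have h := intervalIntegral.continuousOn_primitive_interval' (hint2 x hx) (show (1 : ℝ) ∈ uIcc 1 x from left_mem_uIcc)
      rw [uIcc_of_le hx] at h; exact h
  have hΦd : ∀ y ∈ Ioo 1 x, HasDerivAt Φ 0 y := by
    intro y hy
    have hy0 : 0 < y := lt_trans one_pos hy.1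
    have hlogy : Real.log y ≠ 0 := (Real.log_pos hy.1).ne'
    have hG' : HasDerivAt (tmplG R S δ M) (densG R S δ M y) y := hasDerivAt_tmplG hδ hδ1 hy.1
    have h2 : HasDerivAt Real.log y⁻¹ y := Real.hasDerivAt_log hy0.ne'
    have h3 : HasDerivAt (fun z ↦ ∫ u in (1 : ℝ)..z, tmplG R S δ M u / u) (tmplG R S δ M y / y) y := by
      have hco : ContinuousOn (fun u ↦ tmplG R S δ M u / u) (Ioo 0 (x + 1)) := hGdiv.mono fun u hu ↦ hu.1
      have hy' : y ∈ Ioo 0 (x + 1) := ⟨hy0, by linarith [hy.2]⟩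
      exact intervalIntegral.integral_hasDerivAt_right (hint1 y hy.1.le)
        (hco.stronglyMeasurableAtFilter (μ := volume) isOpen_Ioo y hy') (hco.continuousAt (Ioo_mem_nhds hy'.1 hy'.2))
    have h4 : HasDerivAt (fun z ↦ ∫ u in (1 : ℝ)..z, NG R S δ M (Real.log u) / u) (NG R S δ M (Real.log y) / y) y := by
      have hco : ContinuousOn (fun u ↦ NG R S δ M (Real.log u) / u) (Ioo 0 (x + 1)) := hN.mono fun u hu ↦ hu.1
      have hy' : y ∈ Ioo 0 (x + 1) := ⟨hy0, by linarith [hy.2]⟩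
      exact intervalIntegral.integral_hasDerivAt_right (hint2 y hy.1.le)
        (hco.stronglyMeasurableAtFilter (μ := volume) isOpen_Ioo y hy') (hco.continuousAt (Ioo_mem_nhds hy'.1 hy'.2))
    have h5 : HasDerivAt Φ ((densG R S δ M y * Real.log y + tmplG R S δ M y * y⁻¹) - tmplG R S δ M y / y -
        NG R S δ M (Real.log y) / y) y := ((hG'.mul h2).sub h3).sub h4
    convert h5 using 1
    rw [densG_of_one_lt hy.1]
    field_simp
    ring
  obtain ⟨c, _, hc⟩ := exists_hasDerivAt_eq_slope Φ (fun _ ↦ 0) h1 hΦc hΦd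
  have hΦ1 : Φ 1 = 0 := by simp [hΦ, tmplG_of_le_one (le_refl (1:ℝ))]
  have hΦx : Φ x = 0 := by
    rw [eq_comm, div_eq_iff (show x - 1 ≠ 0 by linarith), zero_mul] at hc
    linarith
  simpa [hΦ, sub_eq_zero] using hΦx

/-- `∫_1^x Re(u^z − 1)/u du = Re((x^z − 1)/z − log x)` for `z ≠ 0`, `x ≥ 1` (`(u^z − 1)/u = log u · cpowDensity z u`).
[cite: BrouckeDebruyneRevesz2023, proof of Theorem 3.2] -/
theorem integral_re_cpow_sub_one_div {z : ℂ} (hz : z ≠ 0) {x : ℝ} (hx : 1 ≤ x) :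
    ∫ u in (1 : ℝ)..x, ((u : ℂ) ^ z - 1).re / u = ((((x : ℂ) ^ z - 1) / z - (Real.log x : ℂ))).re := by
  have heq : ∀ u ∈ uIcc (1 : ℝ) x, ((u : ℂ) ^ z - 1).re / u = ((Real.log u : ℂ) * cpowDensity z u).re := by
    intro u hu
    rw [uIcc_of_le hx] at hu
    have hu0 : 0 < u := lt_of_lt_of_le one_pos hu.1
    have hu0' : (u : ℂ) ≠ 0 := ofReal_ne_zero.2 hu0.ne'
    rw [log_mul_cpowDensity hu.1, Complex.cpow_sub _ _ hu0', Complex.cpow_one]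
    have : ((u : ℂ) ^ z / u - (u : ℂ)⁻¹) = ((u : ℂ) ^ z - 1) / u := by field_simp
    rw [this, Complex.div_ofReal_re]
  rw [intervalIntegral.integral_congr heq]
  have hint : IntervalIntegrable (fun u ↦ (Real.log u : ℂ) * cpowDensity z u) volume 1 x := by
    refine ContinuousOn.intervalIntegrable ?_
    rw [uIcc_of_le hx]
    intro u hu
    rcases hu.1.eq_or_lt with h | h
    all_goals
      refine (ContinuousOn.congr (f := fun u : ℝ ↦ (u : ℂ) ^ (z - 1) - (u : ℂ)⁻¹) ?_ ?_ ) u hu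
      · intro v hv
        have hv0 : 0 < v := lt_of_lt_of_le one_pos hv.1
        exact ContinuousAt.continuousWithinAt
          ((ContinuousAt.cpow Complex.continuous_ofReal.continuousAt continuousAt_const (Or.inl (by simpa using hv0))).sub
            (Complex.continuous_ofReal.continuousAt.inv₀ (ofReal_ne_zero.2 hv0.ne')))
      · intro v hv; exact log_mul_cpowDensity hv.1 z
  have h := RCLike.reCLM.intervalIntegral_comp_comm hint
  simp only [RCLike.reCLM_apply, RCLike.re_to_complex] at h
  rw [h, integral_log_mul_cpowDensity hz hx]

/-- **`∫_1^x NG(log u) du/u = (x − 1 − log x) + Σ_𝒮 Re((x^ω − 1)/ω − log x) − Σ_ℛ Re((x^ρ − 1)/ρ − log x) +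
M((x^δ − 1)/δ − log x)`** for `x ≥ 1` (`Re ω, Re ρ > 0`, `0 < δ ≤ 1`): BDR's "`∫_1^x log u dLi(u^z) = (x^z − 1)/z − log x`"
summed over the template (`Re ω, Re ρ > 0`, `δ > 0`). [cite: BrouckeDebruyneRevesz2023, proof of Theorem 3.2] -/
theorem integral_NG_log_div (hS : ∀ ω ∈ S, 0 < ω.re) (hR : ∀ ρ ∈ R, 0 < ρ.re) (hδ : 0 < δ) {x : ℝ} (hx : 1 ≤ x) :
    ∫ u in (1 : ℝ)..x, NG R S δ M (Real.log u) / u =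
      (x - 1 - Real.log x) + (S.map fun ω ↦ ((((x : ℂ) ^ ω - 1) / ω - (Real.log x : ℂ))).re).sum -
        (R.map fun ρ ↦ ((((x : ℂ) ^ ρ - 1) / ρ - (Real.log x : ℂ))).re).sum + M * ((x ^ δ - 1) / δ - Real.log x) := by
  classical
  have hx0 : 0 < x := by linarith
  -- rewrite the integrand with `NG_log_eq`
  have heq : ∀ u ∈ uIcc (1 : ℝ) x, NG R S δ M (Real.log u) / u =
      (u - 1) / u + (∑ ω ∈ S.toFinset, (S.count ω : ℝ) * (((u : ℂ) ^ ω - 1).re / u)) -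
        (∑ ρ ∈ R.toFinset, (R.count ρ : ℝ) * (((u : ℂ) ^ ρ - 1).re / u)) + M * ((u ^ δ - 1) / u) := by
    intro u hu
    rw [uIcc_of_le hx] at hu
    have hu0 : 0 < u := lt_of_lt_of_le one_pos hu.1
    rw [NG_log_eq R S δ M hu0, Finset.sum_multiset_map_count, Finset.sum_multiset_map_count]
    simp only [nsmul_eq_mul, Finset.sum_div, add_div, sub_div, mul_div_assoc]
  rw [intervalIntegral.integral_congr heq]
  -- integrability of the pieces (continuous on `[1, x]`)
  have hcz : ∀ z : ℂ, ContinuousOn (fun u : ℝ ↦ ((u : ℂ) ^ z - 1).re / u) (uIcc 1 x) := by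
    intro z
    rw [uIcc_of_le hx]
    intro u hu
    have hu0 : 0 < u := lt_of_lt_of_le one_pos hu.1
    refine ContinuousAt.continuousWithinAt ?_
    refine ContinuousAt.div ?_ continuousAt_id hu0.ne'
    exact (Complex.continuous_re.continuousAt).comp
      ((ContinuousAt.cpow Complex.continuous_ofReal.continuousAt continuousAt_const (Or.inl (by simpa using hu0))).sub
        continuousAt_const)
  have hiz : ∀ z : ℂ, IntervalIntegrable (fun u : ℝ ↦ ((u : ℂ) ^ z - 1).re / u) volume 1 x := fun z ↦
    (hcz z).intervalIntegrable
  have hi1 : IntervalIntegrable (fun u : ℝ ↦ (u - 1) / u) volume 1 x := by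
    refine ContinuousOn.intervalIntegrable ?_
    rw [uIcc_of_le hx]
    exact (continuousOn_id.sub continuousOn_const).div continuousOn_id fun u hu ↦ ne_of_gt (lt_of_lt_of_le one_pos hu.1)
  have hiδ : IntervalIntegrable (fun u : ℝ ↦ (u ^ δ - 1) / u) volume 1 x := by
    refine ContinuousOn.intervalIntegrable ?_
    rw [uIcc_of_le hx]
    intro u hu
    have hu0 : 0 < u := lt_of_lt_of_le one_pos hu.1
    exact ContinuousAt.continuousWithinAt
      (((ContinuousAt.rpow_const continuousAt_id (Or.inl hu0.ne')).sub continuousAt_const).div continuousAt_id hu0.ne')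
  have hiS : IntervalIntegrable (fun u : ℝ ↦ ∑ ω ∈ S.toFinset, (S.count ω : ℝ) * (((u : ℂ) ^ ω - 1).re / u)) volume 1 x := by
    have h := IntervalIntegrable.sum S.toFinset fun ω _ ↦ (hiz ω).const_mul (S.count ω : ℝ)
    have hfun : (∑ i ∈ S.toFinset, fun u : ℝ ↦ (S.count i : ℝ) * (((u : ℂ) ^ i - 1).re / u)) =
        fun u : ℝ ↦ ∑ ω ∈ S.toFinset, (S.count ω : ℝ) * (((u : ℂ) ^ ω - 1).re / u) := by
      funext u; simp [Finset.sum_apply]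
    rwa [hfun] at h
  have hiR : IntervalIntegrable (fun u : ℝ ↦ ∑ ρ ∈ R.toFinset, (R.count ρ : ℝ) * (((u : ℂ) ^ ρ - 1).re / u)) volume 1 x := by
    have h := IntervalIntegrable.sum R.toFinset fun ρ _ ↦ (hiz ρ).const_mul (R.count ρ : ℝ)
    have hfun : (∑ i ∈ R.toFinset, fun u : ℝ ↦ (R.count i : ℝ) * (((u : ℂ) ^ i - 1).re / u)) =
        fun u : ℝ ↦ ∑ ρ ∈ R.toFinset, (R.count ρ : ℝ) * (((u : ℂ) ^ ρ - 1).re / u) := by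
      funext u; simp [Finset.sum_apply]
    rwa [hfun] at h
  rw [intervalIntegral.integral_add ((hi1.add hiS).sub hiR) (hiδ.const_mul _),
    intervalIntegral.integral_sub (hi1.add hiS) hiR, intervalIntegral.integral_add hi1 hiS,
    intervalIntegral.integral_finsetSum fun ω _ ↦ (hiz ω).const_mul _,
    intervalIntegral.integral_finsetSum fun ρ _ ↦ (hiz ρ).const_mul _, intervalIntegral.integral_const_mul]
  simp only [intervalIntegral.integral_const_mul]
  -- evaluate the pieces
  have e1 : ∫ u in (1 : ℝ)..x, (u - 1) / u = x - 1 - Real.log x := by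
    have h := integral_re_cpow_sub_one_div (one_ne_zero) hx
    have h2 : ∀ u ∈ uIcc (1 : ℝ) x, ((u : ℂ) ^ (1 : ℂ) - 1).re / u = (u - 1) / u := by
      intro u _; rw [Complex.cpow_one]; simp
    rw [← intervalIntegral.integral_congr h2, h]
    rw [Complex.cpow_one, div_one]
    simp
  have eS : ∑ ω ∈ S.toFinset, (S.count ω : ℝ) * ∫ u in (1 : ℝ)..x, ((u : ℂ) ^ ω - 1).re / u =
      (S.map fun ω ↦ ((((x : ℂ) ^ ω - 1) / ω - (Real.log x : ℂ))).re).sum := by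
    rw [Finset.sum_multiset_map_count]
    refine Finset.sum_congr rfl fun ω hω ↦ ?_
    rw [Multiset.mem_toFinset] at hω
    rw [nsmul_eq_mul, integral_re_cpow_sub_one_div (fun h ↦ by have := hS ω hω; rw [h] at this; simp at this) hx]
  have eR : ∑ ρ ∈ R.toFinset, (R.count ρ : ℝ) * ∫ u in (1 : ℝ)..x, ((u : ℂ) ^ ρ - 1).re / u =
      (R.map fun ρ ↦ ((((x : ℂ) ^ ρ - 1) / ρ - (Real.log x : ℂ))).re).sum := by
    rw [Finset.sum_multiset_map_count]
    refine Finset.sum_congr rfl fun ρ hρ ↦ ?_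
    rw [Multiset.mem_toFinset] at hρ
    rw [nsmul_eq_mul, integral_re_cpow_sub_one_div (fun h ↦ by have := hR ρ hρ; rw [h] at this; simp at this) hx]
  have eδ : ∫ u in (1 : ℝ)..x, (u ^ δ - 1) / u = (x ^ δ - 1) / δ - Real.log x := by
    have h := integral_re_cpow_sub_one_div (z := δ) (by exact_mod_cast hδ.ne') hx
    have h2 : ∀ u ∈ uIcc (1 : ℝ) x, (((u : ℂ)) ^ ((δ : ℂ)) - 1).re / u = (u ^ δ - 1) / u := by
      intro u hu
      rw [uIcc_of_le hx] at hu
      rw [← Complex.ofReal_cpow (by linarith [hu.1]), ← Complex.ofReal_one, ← Complex.ofReal_sub, Complex.ofReal_re]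
    rw [← intervalIntegral.integral_congr h2, h, ← Complex.ofReal_cpow hx0.le, ← Complex.ofReal_one,
      ← Complex.ofReal_sub, ← Complex.ofReal_div, ← Complex.ofReal_sub, Complex.ofReal_re]
  rw [e1, eS, eR, eδ]

/-! ### The `ψ`-clause -/

/-- `log x ≤ x^δ/δ` and `(log x)² ≤ 4x^δ/δ²` for `x ≥ 1`, `δ > 0`. [folklore] -/
theorem log_sq_le {x δ : ℝ} (hx : 1 ≤ x) (hδ : 0 < δ) :
    Real.log x ≤ x ^ δ / δ ∧ Real.log x ^ 2 ≤ 4 * x ^ δ / δ ^ 2 := by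
  have hx0 : 0 ≤ x := by linarith
  have h1 := Real.log_le_rpow_div hx0 hδ
  have h2 := Real.log_le_rpow_div hx0 (half_pos hδ)
  have hlx : 0 ≤ Real.log x := Real.log_nonneg hx
  refine ⟨h1, ?_⟩
  have h3 : Real.log x ^ 2 ≤ (x ^ (δ / 2) / (δ / 2)) ^ 2 := pow_le_pow_left₀ hlx h2 2
  have h4 : (x ^ (δ / 2)) ^ 2 = x ^ δ := by rw [← Real.rpow_natCast, ← Real.rpow_mul hx0]; norm_num
  calc Real.log x ^ 2 ≤ (x ^ (δ / 2) / (δ / 2)) ^ 2 := h3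
    _ = 4 * x ^ δ / δ ^ 2 := by rw [div_pow, h4]; field_simp; ring

/-- Bound for the `Π_𝒫 − G` contribution to `ψ_𝒫`:
`|(Π_𝒫 − G)(x) log x − ∫_1^x (Π_𝒫 − G)(u) du/u| ≤ C_Π (2 log x + 2 (log x)²)` (`x ≥ 1`). [cite: BrouckeDebruyneRevesz2023, proof of Theorem 3.2] -/
theorem abs_err_riemannPrimeCount_le (hδ : 0 ≤ δ) (hδ1 : δ ≤ 1) {C : ℝ} (hC : 0 ≤ C)
    (hPiG : ∀ u : ℝ, 1 ≤ u → |P.riemannPrimeCount u - tmplG R S δ M u| ≤ C * (1 + Real.log u)) {x : ℝ} (hx : 1 ≤ x) :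
    |(P.riemannPrimeCount x - tmplG R S δ M x) * Real.log x -
        ∫ u in (1 : ℝ)..x, (P.riemannPrimeCount u - tmplG R S δ M u) / u| ≤
      C * (2 * Real.log x + 2 * Real.log x ^ 2) := by
  have hlx : 0 ≤ Real.log x := Real.log_nonneg hx
  have h1 : |(P.riemannPrimeCount x - tmplG R S δ M x) * Real.log x| ≤ C * (1 + Real.log x) * Real.log x := by
    rw [abs_mul, abs_of_nonneg hlx]
    exact mul_le_mul_of_nonneg_right (hPiG x hx) hlx
  -- the integral: `|∫ (Π−G)/u| ≤ ∫ C(1 + log u)/u = C(log x + (log x)²/2)`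
  have hint : IntervalIntegrable (fun u ↦ (P.riemannPrimeCount u - tmplG R S δ M u) / u) volume 1 x := by
    have hG : IntervalIntegrable (fun u ↦ tmplG R S δ M u / u) volume 1 x := by
      refine ContinuousOn.intervalIntegrable ?_
      rw [uIcc_of_le hx]
      exact (continuous_tmplG hδ hδ1).continuousOn.div continuousOn_id fun u hu ↦ ne_of_gt (lt_of_lt_of_le one_pos hu.1)
    have h := (P.intervalIntegrable_riemannPrimeCount_div hx).sub hG
    exact h.congr fun u _ ↦ (sub_div _ _ _).symm
  have hbound : ∀ u ∈ Set.Ioc (1 : ℝ) x, ‖(P.riemannPrimeCount u - tmplG R S δ M u) / u‖ ≤ C * (1 + Real.log u) / u := by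
    intro u hu
    have hu0 : 0 < u := lt_trans one_pos hu.1
    rw [Real.norm_eq_abs, abs_div, abs_of_pos hu0]
    exact div_le_div_of_nonneg_right (hPiG u hu.1.le) hu0.le
  have hcont : ContinuousOn (fun u ↦ C * (1 + Real.log u) / u) (uIcc 1 x) := by
    rw [uIcc_of_le hx]
    refine ContinuousOn.div (continuousOn_const.mul (continuousOn_const.add
      (Real.continuousOn_log.mono fun u hu ↦ ne_of_gt (lt_of_lt_of_le one_pos hu.1)))) continuousOn_id
      fun u hu ↦ ne_of_gt (lt_of_lt_of_le one_pos hu.1)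
  have h2 : |∫ u in (1 : ℝ)..x, (P.riemannPrimeCount u - tmplG R S δ M u) / u| ≤
      ∫ u in (1 : ℝ)..x, C * (1 + Real.log u) / u := by
    have := intervalIntegral.norm_integral_le_of_norm_le hx (ae_of_all _ fun u hu ↦ hbound u hu) (hcont.intervalIntegrable (μ := volume))
    rwa [Real.norm_eq_abs] at this
  have h3 : ∫ u in (1 : ℝ)..x, C * (1 + Real.log u) / u = C * (Real.log x + Real.log x ^ 2 / 2) := by
    have hderiv : ∀ u ∈ uIcc (1 : ℝ) x,
        HasDerivAt (fun u ↦ C * (Real.log u + Real.log u * Real.log u / 2)) (C * (1 + Real.log u) / u) u := by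
      intro u hu
      rw [uIcc_of_le hx] at hu
      have hu0 : 0 < u := lt_of_lt_of_le one_pos hu.1
      have hl := Real.hasDerivAt_log hu0.ne'
      have h := (hl.add ((hl.mul hl).div_const 2)).const_mul C
      have heq : C * (u⁻¹ + (u⁻¹ * Real.log u + Real.log u * u⁻¹) / 2) = C * (1 + Real.log u) / u := by
        field_simp; ring
      rw [heq] at h
      exact h
    rw [intervalIntegral.integral_eq_sub_of_hasDerivAt hderiv hcont.intervalIntegrable, Real.log_one, sq]
    ring
  rw [h3] at h2
  calc _ ≤ |(P.riemannPrimeCount x - tmplG R S δ M x) * Real.log x| +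
        |∫ u in (1 : ℝ)..x, (P.riemannPrimeCount u - tmplG R S δ M u) / u| := abs_sub _ _
    _ ≤ C * (1 + Real.log x) * Real.log x + C * (Real.log x + Real.log x ^ 2 / 2) := add_le_add h1 h2
    _ ≤ C * (2 * Real.log x + 2 * Real.log x ^ 2) := by nlinarith [sq_nonneg (Real.log x)]

/-- `|Re((x^z − 1)/z − log x) − Re(x^z/z)| ≤ ‖z‖⁻¹ + log x` (`x ≥ 1`). [folklore] -/
theorem abs_re_piece_le {z : ℂ} (hz : z ≠ 0) {x : ℝ} (hx : 1 ≤ x) :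
    |((((x : ℂ) ^ z - 1) / z - (Real.log x : ℂ))).re - ((x : ℂ) ^ z / z).re| ≤ ‖z‖⁻¹ + Real.log x := by
  have h : (((x : ℂ) ^ z - 1) / z - (Real.log x : ℂ)) - (x : ℂ) ^ z / z = -(1 / z) - (Real.log x : ℂ) := by
    field_simp; ring
  rw [← Complex.sub_re, h]
  calc |(-(1 / z) - (Real.log x : ℂ)).re| ≤ ‖-(1 / z) - (Real.log x : ℂ)‖ := abs_re_le_norm _
    _ ≤ ‖-(1 / z)‖ + ‖(Real.log x : ℂ)‖ := norm_sub_le _ _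
    _ = ‖z‖⁻¹ + Real.log x := by
        rw [norm_neg, norm_div, norm_one, one_div, Complex.norm_real, Real.norm_eq_abs, abs_of_nonneg (Real.log_nonneg hx)]

/-- **The `ψ`-clause of Theorem 3.2.** If `|π_𝒫(y) − F(y)| ≤ A'` for all `y ≥ 1` (Theorem 1.2), then there is `C`
with `‖ψ_𝒫(x) − (x + Σ_{ω∈𝒮} x^ω/ω − Σ_{ρ∈ℛ} x^ρ/ρ)‖ ≤ C x^δ` for all `x ≥ 1` — the printed
`ψ_𝒫(x) = x + Σ_ω x^ω/ω − Σ_ρ x^ρ/ρ + M x^δ/δ + O(log x log log x)` "which in particular demonstrates the first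
assertion" (here with `O((log x)²)` in place of `O(log x log log x)`). Hypotheses: `𝒮`, `ℛ` symmetric with
`0 < Re ω, Re ρ < 1` (≤ 1 suffices), `0 < δ ≤ 1`, `NF ≥ 0` on `(0,∞)` (Lemma 3.1).
[cite: BrouckeDebruyneRevesz2023, Theorem 3.2 (first clause) and its proof] -/
theorem chebyshevPsi_clause (hSsymm : S.map conj = S) (hRsymm : R.map conj = R)
    (hS : ∀ ω ∈ S, 0 < ω.re ∧ ω.re ≤ 1) (hR : ∀ ρ ∈ R, 0 < ρ.re ∧ ρ.re ≤ 1) (hδ : 0 < δ) (hδ1 : δ ≤ 1)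
    (hpos : ∀ L : ℝ, 0 < L → 0 ≤ NF R S δ M L)
    (hπ : ∀ y : ℝ, 1 ≤ y → |(P.primeCount y : ℝ) - tmplF R S δ M y| ≤ A') :
    ∃ C : ℝ, ∀ x : ℝ, 1 ≤ x →
      ‖(P.chebyshevPsi x : ℂ) -
          ((x : ℂ) + (S.map fun ω ↦ (x : ℂ) ^ ω / ω).sum - (R.map fun ρ ↦ (x : ℂ) ^ ρ / ρ).sum)‖ ≤
        C * x ^ δ := by
  obtain ⟨CP, hCP0, hPiG⟩ := exists_abs_riemannPrimeCount_sub_tmplG_le (fun ω hω ↦ (hS ω hω).2)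
    (fun ρ hρ ↦ (hR ρ hρ).2) hδ.le hδ1 hpos hπ
  -- constants
  set cS : ℝ := (S.map fun ω ↦ ‖ω‖⁻¹).sum with hcS
  set cR : ℝ := (R.map fun ρ ↦ ‖ρ‖⁻¹).sum with hcR
  have hcS0 : 0 ≤ cS := Multiset.sum_nonneg fun y hy ↦ by obtain ⟨z, _, rfl⟩ := Multiset.mem_map.1 hy; positivity
  have hcR0 : 0 ≤ cR := Multiset.sum_nonneg fun y hy ↦ by obtain ⟨z, _, rfl⟩ := Multiset.mem_map.1 hy; positivity
  set C : ℝ := CP * (2 / δ + 8 / δ ^ 2) + (1 + cS + cR) + (1 + Multiset.card S + Multiset.card R + M) / δ + M / δ with hCdef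
  refine ⟨C, fun x hx ↦ ?_⟩
  have hx0 : 0 < x := by linarith
  set L : ℝ := Real.log x with hL
  have hL0 : 0 ≤ L := Real.log_nonneg hx
  obtain ⟨hLle, hL2le⟩ := log_sq_le hx hδ
  have hxδ : 1 ≤ x ^ δ := Real.one_le_rpow hx hδ.le
  -- realness of the complex sums
  have harg : ((x : ℝ) : ℂ).arg ≠ Real.pi := by rw [Complex.arg_ofReal_of_nonneg hx0.le]; exact Real.pi_ne_zero.symm
  have hcpow : ∀ z : ℂ, (x : ℂ) ^ (conj z) = conj ((x : ℂ) ^ z) := fun z ↦ by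
    rw [Complex.cpow_conj _ _ harg, Complex.conj_ofReal]
  have hSre : (S.map fun ω ↦ (x : ℂ) ^ ω / ω).sum = (((S.map fun ω ↦ ((x : ℂ) ^ ω / ω).re).sum : ℝ) : ℂ) :=
    sum_map_eq_ofReal_of_symm hSsymm fun z ↦ by rw [hcpow, ← map_div₀]
  have hRre : (R.map fun ρ ↦ (x : ℂ) ^ ρ / ρ).sum = (((R.map fun ρ ↦ ((x : ℂ) ^ ρ / ρ).re).sum : ℝ) : ℂ) :=
    sum_map_eq_ofReal_of_symm hRsymm fun z ↦ by rw [hcpow, ← map_div₀]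
  -- the real identity for `ψ`
  have hψ := P.chebyshevPsi_eq_riemannPrimeCount_mul_log_sub_integral hx
  have hG := tmplG_mul_log_sub_integral (R := R) (S := S) (M := M) hδ.le hδ1 hx
  have hNG := integral_NG_log_div (M := M) (fun ω hω ↦ (hS ω hω).1) (fun ρ hρ ↦ (hR ρ hρ).1) hδ hx
  -- `∫ Π/u = ∫ (Π−G)/u + ∫ G/u`
  have hintG : IntervalIntegrable (fun u ↦ tmplG R S δ M u / u) volume 1 x := by
    refine ContinuousOn.intervalIntegrable ?_
    rw [uIcc_of_le hx]
    exact (continuous_tmplG hδ.le hδ1).continuousOn.div continuousOn_id fun u hu ↦ ne_of_gt (lt_of_lt_of_le one_pos hu.1)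
  have hsplit : ∫ u in (1 : ℝ)..x, P.riemannPrimeCount u / u =
      (∫ u in (1 : ℝ)..x, (P.riemannPrimeCount u - tmplG R S δ M u) / u) + ∫ u in (1 : ℝ)..x, tmplG R S δ M u / u := by
    rw [← intervalIntegral.integral_add ?_ hintG]
    · exact intervalIntegral.integral_congr fun u _ ↦ by ring
    · have h := (P.intervalIntegrable_riemannPrimeCount_div hx).sub hintG
      exact h.congr fun u _ ↦ (sub_div _ _ _).symm
  -- the error pieces
  have herr := abs_err_riemannPrimeCount_le (R := R) (S := S) (M := M) hδ.le hδ1 hCP0 hPiG hx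
  -- names for the real quantities
  set PG : ℝ := P.riemannPrimeCount x - tmplG R S δ M x with hPG
  set IPG : ℝ := ∫ u in (1 : ℝ)..x, (P.riemannPrimeCount u - tmplG R S δ M u) / u with hIPG
  set IG : ℝ := ∫ u in (1 : ℝ)..x, tmplG R S δ M u / u with hIG
  set sS1 : ℝ := (S.map fun ω ↦ ((((x : ℂ) ^ ω - 1) / ω - (Real.log x : ℂ))).re).sum with hsS1
  set sR1 : ℝ := (R.map fun ρ ↦ ((((x : ℂ) ^ ρ - 1) / ρ - (Real.log x : ℂ))).re).sum with hsR1
  set sS2 : ℝ := (S.map fun ω ↦ ((x : ℂ) ^ ω / ω).re).sum with hsS2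
  set sR2 : ℝ := (R.map fun ρ ↦ ((x : ℂ) ^ ρ / ρ).re).sum with hsR2
  set m : ℝ := (x ^ δ - 1) / δ - L with hm
  have hE : |PG * L - IPG| ≤ CP * (2 * L + 2 * L ^ 2) := herr
  -- the real identity `ψ − main = (PG·L − IPG) − 1 − L + (sS1 − sS2) − (sR1 − sR2) + M m`
  have hreal : P.chebyshevPsi x - (x + sS2 - sR2) = (PG * L - IPG) - 1 - L + (sS1 - sS2) - (sR1 - sR2) + M * m := by
    rw [hψ, hsplit, ← hL]
    have hG' : tmplG R S δ M x * L - IG = (x - 1 - L) + sS1 - sR1 + M * m := by rw [hL, hG, hNG]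
    rw [hPG]
    linear_combination hG'
  -- bounds of the pieces `sS1 − sS2`, `sR1 − sR2`
  have hpiece : ∀ z : ℂ, z ≠ 0 →
      |((((x : ℂ) ^ z - 1) / z - (Real.log x : ℂ))).re - ((x : ℂ) ^ z / z).re| ≤ ‖z‖⁻¹ + L := fun z hz ↦ abs_re_piece_le hz hx
  have hSb : |sS1 - sS2| ≤ cS + Multiset.card S * L := by
    rw [hsS1, hsS2, ← Multiset.sum_map_sub]
    refine Multiset.abs_sum_le_sum_abs.trans ?_
    rw [Multiset.map_map]
    have h := Multiset.sum_map_le_sum_map (s := S)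
      (fun ω ↦ |((((x : ℂ) ^ ω - 1) / ω - (Real.log x : ℂ))).re - ((x : ℂ) ^ ω / ω).re|) (fun ω ↦ ‖ω‖⁻¹ + L)
      fun ω hω ↦ hpiece ω (fun h ↦ by have := (hS ω hω).1; rw [h] at this; simp at this)
    rw [Multiset.sum_map_add] at h
    simp only [Multiset.map_const', Multiset.sum_replicate, nsmul_eq_mul] at h
    exact h
  have hRb : |sR1 - sR2| ≤ cR + Multiset.card R * L := by
    rw [hsR1, hsR2, ← Multiset.sum_map_sub]
    refine Multiset.abs_sum_le_sum_abs.trans ?_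
    rw [Multiset.map_map]
    have h := Multiset.sum_map_le_sum_map (s := R)
      (fun ρ ↦ |((((x : ℂ) ^ ρ - 1) / ρ - (Real.log x : ℂ))).re - ((x : ℂ) ^ ρ / ρ).re|) (fun ρ ↦ ‖ρ‖⁻¹ + L)
      fun ρ hρ ↦ hpiece ρ (fun h ↦ by have := (hR ρ hρ).1; rw [h] at this; simp at this)
    rw [Multiset.sum_map_add] at h
    simp only [Multiset.map_const', Multiset.sum_replicate, nsmul_eq_mul] at h
    exact h
  have hmb : |m| ≤ x ^ δ / δ + L := by
    rw [hm, abs_le]; constructor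
    · have : 0 ≤ (x ^ δ - 1) / δ := div_nonneg (by linarith) hδ.le
      linarith
    · have : (x ^ δ - 1) / δ ≤ x ^ δ / δ := div_le_div_of_nonneg_right (by linarith) hδ.le
      linarith
  have hMb : |(M : ℝ) * m| ≤ M * (x ^ δ / δ) + M * L := by
    rw [abs_mul, Nat.abs_cast]
    calc (M : ℝ) * |m| ≤ M * (x ^ δ / δ + L) := mul_le_mul_of_nonneg_left hmb (Nat.cast_nonneg _)
      _ = _ := by ring
  -- the total in `ℝ`
  have htri : |(PG * L - IPG) - 1 - L + (sS1 - sS2) - (sR1 - sR2) + M * m| ≤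
      |PG * L - IPG| + (1 + L) + |sS1 - sS2| + |sR1 - sR2| + |(M : ℝ) * m| := by
    have e : (PG * L - IPG) - 1 - L + (sS1 - sS2) - (sR1 - sR2) + M * m =
        (PG * L - IPG) + (-(1 + L)) + (sS1 - sS2) + (-(sR1 - sR2)) + M * m := by ring
    rw [e]
    have h1 := abs_add_le ((PG * L - IPG) + (-(1 + L)) + (sS1 - sS2) + (-(sR1 - sR2))) ((M : ℝ) * m)
    have h2 := abs_add_le ((PG * L - IPG) + (-(1 + L)) + (sS1 - sS2)) (-(sR1 - sR2))
    have h3 := abs_add_le ((PG * L - IPG) + (-(1 + L))) (sS1 - sS2)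
    have h4 := abs_add_le (PG * L - IPG) (-(1 + L))
    have h5 : |(-(1 + L))| = 1 + L := by rw [abs_neg, abs_of_nonneg (by linarith)]
    have h6 : |(-(sR1 - sR2))| = |sR1 - sR2| := abs_neg _
    linarith
  have hRbound : |P.chebyshevPsi x - (x + sS2 - sR2)| ≤ C * x ^ δ := by
    rw [hreal]
    have hxδ0 : 0 ≤ x ^ δ := by positivity
    have hcard : 0 ≤ (1 : ℝ) + Multiset.card S + Multiset.card R + M := by positivity
    have g1 : CP * (2 * L + 2 * L ^ 2) ≤ CP * (2 / δ + 8 / δ ^ 2) * x ^ δ := by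
      have h1 : 2 * L + 2 * L ^ 2 ≤ (2 / δ + 8 / δ ^ 2) * x ^ δ := by
        have e : (2 / δ + 8 / δ ^ 2) * x ^ δ = 2 * (x ^ δ / δ) + 2 * (4 * x ^ δ / δ ^ 2) := by ring
        rw [e]; linarith
      calc CP * (2 * L + 2 * L ^ 2) ≤ CP * ((2 / δ + 8 / δ ^ 2) * x ^ δ) := mul_le_mul_of_nonneg_left h1 hCP0
        _ = _ := by ring
    have g2 : (1 : ℝ) + cS + cR ≤ (1 + cS + cR) * x ^ δ := by nlinarith
    have g3 : (1 + Multiset.card S + Multiset.card R + M) * L ≤ (1 + Multiset.card S + Multiset.card R + M) / δ * x ^ δ := by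
      have := mul_le_mul_of_nonneg_left hLle hcard
      calc _ ≤ (1 + Multiset.card S + Multiset.card R + M) * (x ^ δ / δ) := this
        _ = _ := by ring
    have e : C * x ^ δ = CP * (2 / δ + 8 / δ ^ 2) * x ^ δ + (1 + cS + cR) * x ^ δ +
        (1 + Multiset.card S + Multiset.card R + M) / δ * x ^ δ + M / δ * x ^ δ := by rw [hCdef]; ring
    have e2 : (1 + Multiset.card S + Multiset.card R + M) * L = L + Multiset.card S * L + Multiset.card R * L + M * L := by ring
    have e3 : (M : ℝ) * (x ^ δ / δ) = M / δ * x ^ δ := by ring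
    linarith [htri, hE, hSb, hRb, hMb, g1, g2, g3, e, e2, e3]
  -- complexify
  have hcplx : (P.chebyshevPsi x : ℂ) - ((x : ℂ) + (S.map fun ω ↦ (x : ℂ) ^ ω / ω).sum - (R.map fun ρ ↦ (x : ℂ) ^ ρ / ρ).sum) =
      ((P.chebyshevPsi x - (x + sS2 - sR2) : ℝ) : ℂ) := by
    rw [hSre, hRre]; push_cast; ring
  rw [hcplx, Complex.norm_real, Real.norm_eq_abs]
  exact hRbound

end BDRMultiset

end Literature.NumberTheory.BeurlingPrimes
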